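import Literature.RingTheory.FittingIdeal.LocallyFree
import Literature.RingTheory.FittingIdeal.Localization
import Mathlib.RingTheory.Spectrum.Prime.FreeLocus
import Mathlib.RingTheory.LocalRing.Module
import Mathlib.RingTheory.LocalProperties.Basic
import Mathlib.RingTheory.Flat.Stability
import HarnessLib

/-!
# Fitting ideals of finite flat modules of constant rank (Stacks 07ZD, global form)

Topic: `Literature/RingTheory/FittingIdeal`. For a finite flat module `M` over a ring `R` (so
`M_𝔭` is free for every prime `𝔭`, Stacks 00NZ) the local statement Stacks 07ZD
(`Module.nonempty_basis_iff_fittingIdeal`: over a local ring, `M` is free of rank `r` iff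
`Fit_r(M) = R` and `Fit_k(M) = 0` for `k < r`) globalises through "Fitting ideals commute with
localisation" (Stacks 07ZA (3)): if the rank of `M` at every stalk is `r` then `Fit_r(M) = R`,
and `Fit_k(M) = 0` whenever `k` is less than the rank at every stalk.

* `Module.nonempty_basis_localizedModule_of_rankAtStalk` — `M_𝔭` is free of rank `rank_𝔭(M)`;
* `Module.fittingIdeal_eq_top_of_rankAtStalk_eq` — **`Fit_r(M) = R` if `M` has constant rank `r`;**
* `Module.fittingIdeal_eq_bot_of_lt_rankAtStalk` — **`Fit_k(M) = 0` if `k < rank_𝔭(M)` for all `𝔭`.**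

## References

* The Stacks Project, Tag 07ZD (Lemma 15.8.7), Tag 07ZA, Tag 00NZ. [StacksProject]
-/

namespace Literature.RingTheory.FittingIdeal

universe u v

variable {R : Type u} [CommRing R] {M : Type v} [AddCommGroup M] [Module R M]

/-- For a finite flat module, the localisation `M_𝔭` at a prime is free of rank `rank_𝔭(M)`
(finite flat over the local ring `R_𝔭`, hence free, Stacks 00NZ). [cite: StacksProject, Tag 00NZ] -/
theorem Module.nonempty_basis_localizedModule_of_rankAtStalk [Module.Finite R M] [Module.Flat R M]
    (p : PrimeSpectrum R) :
    Nonempty (Module.Basis (Fin (Module.rankAtStalk M p)) (Localization.AtPrime p.asIdeal)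
      (LocalizedModule p.asIdeal.primeCompl M)) := by
  haveI : Module.Finite (Localization.AtPrime p.asIdeal) (LocalizedModule p.asIdeal.primeCompl M) :=
    Module.Finite.of_isLocalizedModule p.asIdeal.primeCompl (LocalizedModule.mkLinearMap _ _)
  haveI : Module.Free (Localization.AtPrime p.asIdeal) (LocalizedModule p.asIdeal.primeCompl M) :=
    Module.free_of_flat_of_isLocalRing
  exact ⟨Module.finBasisOfFinrankEq _ _ rfl⟩

/-- **`Fit_r(M) = R` for a finite flat module of constant rank `r`** (Stacks 07ZD at every
localisation, Stacks 07ZA (3)). [cite: StacksProject, Tag 07ZD] -/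
theorem Module.fittingIdeal_eq_top_of_rankAtStalk_eq [Module.Finite R M] [Module.Flat R M] {r : ℕ}
    (h : ∀ p : PrimeSpectrum R, Module.rankAtStalk M p = r) : Module.fittingIdeal R M r = ⊤ := by
  by_contra hne
  obtain ⟨m, hmax, hle⟩ := Ideal.exists_le_maximal _ hne
  haveI := hmax.isPrime
  let P : PrimeSpectrum R := ⟨m, hmax.isPrime⟩
  haveI : Module.Finite (Localization.AtPrime m) (LocalizedModule m.primeCompl M) :=
    Module.Finite.of_isLocalizedModule m.primeCompl (LocalizedModule.mkLinearMap _ _)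
  obtain ⟨b⟩ := Module.nonempty_basis_localizedModule_of_rankAtStalk (M := M) P
  rw [h P] at b
  have htop := (Module.nonempty_basis_iff_fittingIdeal.mp ⟨b⟩).1
  rw [Module.fittingIdeal_of_isLocalizedModule m.primeCompl (Localization.AtPrime m)
      (LocalizedModule.mkLinearMap m.primeCompl M) r] at htop
  -- `Fit_r(M) R_𝔪 ⊆ 𝔪 R_𝔪 ≠ R_𝔪`
  have hle' : (Module.fittingIdeal R M r).map (algebraMap R (Localization.AtPrime m)) ≤
      IsLocalRing.maximalIdeal (Localization.AtPrime m) := by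
    rw [← Localization.AtPrime.map_eq_maximalIdeal]
    exact Ideal.map_mono hle
  rw [htop, top_le_iff] at hle'
  exact (IsLocalRing.maximalIdeal.isMaximal _).ne_top hle'

/-- **`Fit_k(M) = 0` for a finite flat module whose rank at every stalk exceeds `k`** (Stacks 07ZD
at every localisation; an ideal vanishing in every localisation at a maximal ideal vanishes).
[cite: StacksProject, Tag 07ZD] -/
theorem Module.fittingIdeal_eq_bot_of_lt_rankAtStalk [Module.Finite R M] [Module.Flat R M] {k : ℕ}
    (h : ∀ p : PrimeSpectrum R, k < Module.rankAtStalk M p) : Module.fittingIdeal R M k = ⊥ := by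
  refine ideal_eq_bot_of_localization' _ fun m hmax => ?_
  haveI := hmax.isPrime
  let P : PrimeSpectrum R := ⟨m, hmax.isPrime⟩
  haveI : Module.Finite (Localization.AtPrime m) (LocalizedModule m.primeCompl M) :=
    Module.Finite.of_isLocalizedModule m.primeCompl (LocalizedModule.mkLinearMap _ _)
  obtain ⟨b⟩ := Module.nonempty_basis_localizedModule_of_rankAtStalk (M := M) P
  have hbot := (Module.nonempty_basis_iff_fittingIdeal.mp ⟨b⟩).2 k (h P)
  rwa [Module.fittingIdeal_of_isLocalizedModule m.primeCompl (Localization.AtPrime m)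
      (LocalizedModule.mkLinearMap m.primeCompl M) k] at hbot

end Literature.RingTheory.FittingIdeal
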